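import Mathlib
import HarnessLib
import Literature.Analysis.Calculus.SecondDifferenceBound
import Literature.Analysis.Calculus.IteratedDifferenceDerivBound
import Literature.MathematicalPhysics.QuantumLattice.HubbardSliceSymbolSmoothMomentum
import Summits.HubbardSuperconductivity.HubbardSuperconductivity.Theorems.KLProgrammeH10TwoPointLimitLineDerivTwo

/-!
# Route `KLProgramme` — engine support (route (L2), ADDITIVE weight): the single-slice propagator symbol composed with a `C²` band —
# first and second differences along lattice lines (the anisotropic first-order term kept explicit) and in the frequency

Cell `gate-hubbard-kl`, seat hubbard-kl-k3c2-p3 (row «sector-counting import (DR2000 L11/L12) for the leg-dress bar»), for the ENGINE child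
stmt-HubbardSuperconductivity-19823 (`stub_engine_step_norms`: the propagator constant `α_n` on an admissible frame).  The symbol of the zero-seed
counterterm slice `C^K_{(Λ,Λ′]}` (`HubbardCovarianceCTNormalForm.hubbardCovSliceCT_zero_seed`) at `(ω, k⃗)` is
`Ψ̂_ω(e_K(k⃗)) = sliceSymbolFnXi c 0 Λ Λ′ ω (e_K(p_{k⃗}))` (`c = βL²`), Literature's `C²` profile (`HubbardSliceSymbolSmoothMomentum`:
`‖Ψ̂′‖ ≤ (16B₁+16)c/Λ²`, `‖Ψ̂″‖ ≤ (32B₂+144B₁+128)c/Λ³`) composed with the frame band `e_K : Momentum → ℝ`, of which an admissible frame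
controls exactly two derivatives (`FrameOK` (i): `‖D²e_K‖ ≤ 7`).  The master lemma
`KLProgrammeKLRegimeTorusL1SecondDifferences.sum_norm_charSum_le_of_second_differences` asks for POINTWISE single-direction second differences;
here they are produced for the propagator factor, by the mean value inequality twice (`Literature.Analysis.norm_fwdDiff_iter_two_le`) along the
path `s ↦ e(q + s•w)` (p4's `…LineDerivTwo`: `deriv_line_eq_fderiv`, `abs_iteratedDeriv_two_line_le`, `abs_fderiv_line_le`):

* §1 `hasDerivAt_sliceSymbolFnXi_comp`, `hasDerivAt_sliceSymbolFnXi_comp_deriv` — chain rule for `h = Ψ̂_ω ∘ ξ` along a `C²` path `ξ`, with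
  `‖h′‖ ≤ (16B₁+16)(c/Λ²)|ξ′|`, `‖h″‖ ≤ (32B₂+144B₁+128)(c/Λ³)ξ′² + (16B₁+16)(c/Λ²)|ξ″|`;
* §2 **`norm_fwdDiff_two_sliceSymbol_line_le`** — for `e : V → ℝ` of class `C²` with `‖D²e‖ ≤ K₂`:
  `‖Δ_w²[p ↦ Ψ̂_ω(e p)](q)‖ ≤ (32B₂+144B₁+128)(c/Λ³)(|De(q)w| + 2K₂‖w‖²)² + (16B₁+16)(c/Λ²)K₂‖w‖²` — along the tangent of the frame's
  Fermi curve `|De(q)w|` is small, which is the anisotropic gain; **`norm_fwdDiff_sliceSymbol_line_le`** (first difference) and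
  **`norm_sliceSymbolFnXi_le`** (`‖Ψ̂‖ ≤ 4c/Λ`);
* §3 **`norm_fwdDiff_two_sliceSymbol_freq_le`** — in the frequency: `‖Δ_δ²[t ↦ Ψ_ξ(t)](ω)‖ ≤ δ²(32B₂+144B₁+128)c/Λ³` (`δ ≥ 0`).

Everything is proved; no definitions, no named facts. [folklore]

References: G. Benfatto, A. Giuliani, V. Mastropietro, Ann. Henri Poincaré 7 (2006) 809–898, (2.36aa), (2.50), Lemma 2.2; M. Disertori, V. Rivasseau,
Comm. Math. Phys. 215 (2000) 251–290, App. A Lemma 12; M. Salmhofer, *Renormalization* (1999), §4.2.5 (4.70)–(4.71).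
-/

noncomputable section

namespace Summit.HubbardSuperconductivity.HubbardSuperconductivity.Theorems.TorusFourierL2

set_option linter.dupNamespace false -- summit = problem name (single-conjunct summit), D-0017

open Set Complex Literature.MathematicalPhysics.QuantumLattice Literature.Probability.LatticeModels

/-! ### §1 The slice symbol along a `C²` path -/

section Path

variable {c Λ Λ' ω : ℝ}

/-- `|0| ≤ Λ/4` for `Λ > 0` (the unshifted case of Literature's shifted-slice lemmas). [folklore] -/
theorem abs_zero_le_quarter (hΛ : 0 < Λ) : |(0 : ℝ)| ≤ Λ / 4 := by
  rw [abs_zero]; positivity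

/-- **Chain rule**: along a path `ξ` with `HasDerivAt ξ (ξ′ s) s`, `h = Ψ̂_ω ∘ ξ` has derivative `ξ′(s) • Ψ̂′_ω(ξ s)`. [folklore] -/
theorem hasDerivAt_sliceSymbolFnXi_comp (hΛ : 0 < Λ) (hΛΛ' : Λ ≤ Λ') {ξ : ℝ → ℝ} {ξ' : ℝ} {s : ℝ} (hξ : HasDerivAt ξ ξ' s) :
    HasDerivAt (fun t => sliceSymbolFnXi c 0 Λ Λ' ω (ξ t)) (ξ' • sliceSymbolFnXiD1 c 0 Λ Λ' ω (ξ s)) s :=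
  (hasDerivAt_sliceSymbolFnXi hΛ hΛΛ' (abs_zero_le_quarter hΛ) (ξ s)).scomp s hξ

/-- **Chain rule, second order**: if moreover `HasDerivAt ξ′ (ξ″ s) s`, the derivative `t ↦ ξ′(t) • Ψ̂′_ω(ξ t)` has derivative
`ξ′(s)² • Ψ̂″_ω(ξ s) + ξ″(s) • Ψ̂′_ω(ξ s)`. [folklore] -/
theorem hasDerivAt_sliceSymbolFnXi_comp_deriv (hΛ : 0 < Λ) (hΛΛ' : Λ ≤ Λ') {ξ ξd : ℝ → ℝ} {ξdd : ℝ} {s : ℝ}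
    (hξ : HasDerivAt ξ (ξd s) s) (hξd : HasDerivAt ξd ξdd s) :
    HasDerivAt (fun t => ξd t • sliceSymbolFnXiD1 c 0 Λ Λ' ω (ξ t))
      (ξd s ^ 2 • sliceSymbolFnXiD2 c 0 Λ Λ' ω (ξ s) + ξdd • sliceSymbolFnXiD1 c 0 Λ Λ' ω (ξ s)) s := by
  have hinner : HasDerivAt (fun t => sliceSymbolFnXiD1 c 0 Λ Λ' ω (ξ t)) (ξd s • sliceSymbolFnXiD2 c 0 Λ Λ' ω (ξ s)) s :=
    (hasDerivAt_sliceSymbolFnXiD1 hΛ hΛΛ' (abs_zero_le_quarter hΛ) (ξ s)).scomp s hξ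
  have h := hξd.smul hinner
  refine h.congr_deriv ?_
  rw [smul_smul, sq, add_comm]

/-- The norm of the first derivative along the path: `‖ξ′ • Ψ̂′‖ ≤ (16B₁+16)(c/Λ²)·|ξ′|`. [folklore] -/
theorem norm_deriv_path_le (hΛ : 0 < Λ) (hΛΛ' : Λ ≤ Λ') (hc : 0 ≤ c) {B₁ : ℝ} (hB₁ : ∀ x, |deriv salmhoferCutoff x| ≤ B₁)
    (ξ₀ ξd : ℝ) : ‖ξd • sliceSymbolFnXiD1 c 0 Λ Λ' ω ξ₀‖ ≤ (16 * B₁ + 16) * c / Λ ^ 2 * |ξd| := by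
  rw [norm_smul, Real.norm_eq_abs, mul_comm]
  exact mul_le_mul_of_nonneg_right (norm_sliceSymbolFnXiD1_le hΛ hΛΛ' (abs_zero_le_quarter hΛ) hc hB₁ ξ₀) (abs_nonneg _)

/-- The norm of the second derivative along the path:
`‖ξ′² • Ψ̂″ + ξ″ • Ψ̂′‖ ≤ (32B₂+144B₁+128)(c/Λ³)ξ′² + (16B₁+16)(c/Λ²)|ξ″|`. [folklore] -/
theorem norm_deriv_two_path_le (hΛ : 0 < Λ) (hΛΛ' : Λ ≤ Λ') (hc : 0 ≤ c) {B₁ B₂ : ℝ} (hB₁ : ∀ x, |deriv salmhoferCutoff x| ≤ B₁)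
    (hB₂ : ∀ x, |deriv (deriv salmhoferCutoff) x| ≤ B₂) (ξ₀ ξd ξdd : ℝ) :
    ‖ξd ^ 2 • sliceSymbolFnXiD2 c 0 Λ Λ' ω ξ₀ + ξdd • sliceSymbolFnXiD1 c 0 Λ Λ' ω ξ₀‖ ≤
      (32 * B₂ + 144 * B₁ + 128) * c / Λ ^ 3 * ξd ^ 2 + (16 * B₁ + 16) * c / Λ ^ 2 * |ξdd| := by
  refine (norm_add_le _ _).trans (add_le_add ?_ (norm_deriv_path_le hΛ hΛΛ' hc hB₁ ξ₀ ξdd))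
  rw [norm_smul, Real.norm_eq_abs, abs_of_nonneg (sq_nonneg _), mul_comm]
  exact mul_le_mul_of_nonneg_right (norm_sliceSymbolFnXiD2_le hΛ hΛΛ' (abs_zero_le_quarter hΛ) hc hB₁ hB₂ ξ₀) (sq_nonneg _)

/-- **The sup of the slice symbol**: `‖Ψ̂_ω(ξ)‖ ≤ 4c/Λ` everywhere (on the shell the denominator is at least `Λ/4`, off it the weight vanishes).
[cite: BenfattoGiulianiMastropietro2006, §2.5 (2.50)] -/
theorem norm_sliceSymbolFnXi_le (hΛ : 0 < Λ) (hΛΛ' : Λ ≤ Λ') (hc : 0 ≤ c) (ξ : ℝ) : ‖sliceSymbolFnXi c 0 Λ Λ' ω ξ‖ ≤ 4 * c / Λ := by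
  unfold sliceSymbolFnXi
  by_cases hmem : ξ ^ 2 + ω ^ 2 < Λ ^ 2 / 4 ∨ Λ' ^ 2 < ξ ^ 2 + ω ^ 2
  · rw [(sliceWeightFn_eq_zero_of_not_mem hΛ hΛΛ' hmem).1, Complex.ofReal_zero, zero_mul, norm_zero]
    positivity
  · have hshell : Λ ^ 2 / 4 ≤ ω ^ 2 + ξ ^ 2 := by
      rw [not_or, not_lt, not_lt] at hmem; linarith [hmem.1]
    have hden := norm_shiftDen_ge (abs_zero_le_quarter hΛ) hshell
    have hden0 : 0 < ‖-I * ((ω + 0 : ℝ) : ℂ) + (ξ : ℂ)‖ := lt_of_lt_of_le (by positivity) hden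
    rw [norm_mul, Complex.norm_real, Real.norm_eq_abs, norm_resolventFnXi hc]
    calc |sliceWeightFn Λ Λ' ω ξ| * (c / ‖-I * ((ω + 0 : ℝ) : ℂ) + (ξ : ℂ)‖) ≤ 1 * (c / (Λ / 4)) :=
          mul_le_mul (abs_sliceWeightFn_le_one Λ Λ' ω ξ) (div_le_div_of_nonneg_left hc (by positivity) hden) (by positivity)
            zero_le_one
      _ = 4 * c / Λ := by field_simp

/-- **Second difference along a `C²` path** (mean value inequality twice): if `ξ` has derivatives `ξ′, ξ″` on `[x, x+2δ]` with `|ξ′| ≤ a` and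
`|ξ″| ≤ b` there (`δ ≥ 0`), then `‖Δ_δ²(Ψ̂_ω ∘ ξ)(x)‖ ≤ δ²·[(32B₂+144B₁+128)(c/Λ³)a² + (16B₁+16)(c/Λ²)b]`.
[cite: BenfattoGiulianiMastropietro2006, (2.36aa)] -/
theorem norm_fwdDiff_two_sliceSymbol_path_le (hΛ : 0 < Λ) (hΛΛ' : Λ ≤ Λ') (hc : 0 ≤ c) {B₁ B₂ : ℝ}
    (hB₁ : ∀ x, |deriv salmhoferCutoff x| ≤ B₁) (hB₂ : ∀ x, |deriv (deriv salmhoferCutoff) x| ≤ B₂)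
    {ξ ξd ξdd : ℝ → ℝ} {x δ a b : ℝ} (hδ : 0 ≤ δ)
    (hξ : ∀ t ∈ Icc x (x + 2 * δ), HasDerivAt ξ (ξd t) t) (hξd : ∀ t ∈ Icc x (x + 2 * δ), HasDerivAt ξd (ξdd t) t)
    (ha : ∀ t ∈ Icc x (x + 2 * δ), |ξd t| ≤ a) (hb : ∀ t ∈ Icc x (x + 2 * δ), |ξdd t| ≤ b) :
    ‖(fwdDiff δ)^[2] (fun t => sliceSymbolFnXi c 0 Λ Λ' ω (ξ t)) x‖ ≤
      δ ^ 2 * ((32 * B₂ + 144 * B₁ + 128) * c / Λ ^ 3 * a ^ 2 + (16 * B₁ + 16) * c / Λ ^ 2 * b) := by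
  have hB10 : 0 ≤ B₁ := (abs_nonneg _).trans (hB₁ 0)
  have hB20 : 0 ≤ B₂ := (abs_nonneg _).trans (hB₂ 0)
  refine Literature.Analysis.norm_fwdDiff_iter_two_le hδ
    (f' := fun t => ξd t • sliceSymbolFnXiD1 c 0 Λ Λ' ω (ξ t))
    (f'' := fun t => ξd t ^ 2 • sliceSymbolFnXiD2 c 0 Λ Λ' ω (ξ t) + ξdd t • sliceSymbolFnXiD1 c 0 Λ Λ' ω (ξ t))
    (fun t ht => hasDerivAt_sliceSymbolFnXi_comp hΛ hΛΛ' (hξ t ht))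
    (fun t ht => hasDerivAt_sliceSymbolFnXi_comp_deriv hΛ hΛΛ' (hξ t ht) (hξd t ht)) fun t ht => ?_
  refine (norm_deriv_two_path_le hΛ hΛΛ' hc hB₁ hB₂ (ξ t) (ξd t) (ξdd t)).trans ?_
  have h1 : ξd t ^ 2 ≤ a ^ 2 := by
    rw [← sq_abs]; exact pow_le_pow_left₀ (abs_nonneg _) (ha t ht) 2
  have h2 := hb t ht
  have hc3 : 0 ≤ (32 * B₂ + 144 * B₁ + 128) * c / Λ ^ 3 := by positivity
  have hc2 : 0 ≤ (16 * B₁ + 16) * c / Λ ^ 2 := by positivity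
  nlinarith [mul_le_mul_of_nonneg_left h1 hc3, mul_le_mul_of_nonneg_left h2 hc2]

/-- **First difference along a `C²` path**: `‖Δ_δ(Ψ̂_ω ∘ ξ)(x)‖ ≤ δ·(16B₁+16)(c/Λ²)·a` when `|ξ′| ≤ a` on `[x, x+δ]`.
[cite: BenfattoGiulianiMastropietro2006, (2.36aa)] -/
theorem norm_fwdDiff_sliceSymbol_path_le (hΛ : 0 < Λ) (hΛΛ' : Λ ≤ Λ') (hc : 0 ≤ c) {B₁ : ℝ}
    (hB₁ : ∀ x, |deriv salmhoferCutoff x| ≤ B₁) {ξ ξd : ℝ → ℝ} {x δ a : ℝ} (hδ : 0 ≤ δ)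
    (hξ : ∀ t ∈ Icc x (x + δ), HasDerivAt ξ (ξd t) t) (ha : ∀ t ∈ Icc x (x + δ), |ξd t| ≤ a) :
    ‖fwdDiff δ (fun t => sliceSymbolFnXi c 0 Λ Λ' ω (ξ t)) x‖ ≤ δ * ((16 * B₁ + 16) * c / Λ ^ 2 * a) := by
  have hB10 : 0 ≤ B₁ := (abs_nonneg _).trans (hB₁ 0)
  rw [fwdDiff]
  refine Literature.Analysis.norm_sub_le_of_norm_deriv_le hδ (f' := fun t => ξd t • sliceSymbolFnXiD1 c 0 Λ Λ' ω (ξ t))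
    (fun t ht => hasDerivAt_sliceSymbolFnXi_comp hΛ hΛΛ' (hξ t ht)) fun t ht => ?_
  refine (norm_deriv_path_le hΛ hΛΛ' hc hB₁ (ξ t) (ξd t)).trans ?_
  exact mul_le_mul_of_nonneg_left (ha t ht) (by positivity)

end Path

/-! ### §2 The line instance: `ξ(s) = e(q + s•w)` for a `C²` band `e` with `‖D²e‖ ≤ K₂` -/

section Line

variable {V : Type*} [NormedAddCommGroup V] [NormedSpace ℝ V] {c Λ Λ' ω : ℝ}

/-- The path `s ↦ e(q + s•w)` has derivative `De(q + s•w)·w`. [folklore] -/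
theorem hasDerivAt_line {e : V → ℝ} (he : ContDiff ℝ 2 e) (q w : V) (s : ℝ) :
    HasDerivAt (fun s : ℝ => e (q + s • w)) (fderiv ℝ e (q + s • w) w) s := by
  have hd : Differentiable ℝ (fun s : ℝ => e (q + s • w)) := (contDiff_two_line he q w).differentiable (by norm_num)
  have h := (hd s).hasDerivAt
  rwa [deriv_line_eq_fderiv he q w s] at h

/-- The derivative path `s ↦ De(q + s•w)·w` has derivative `∂ₛ²e(q + s•w)`. [folklore] -/
theorem hasDerivAt_line_deriv {e : V → ℝ} (he : ContDiff ℝ 2 e) (q w : V) (s : ℝ) :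
    HasDerivAt (fun s : ℝ => fderiv ℝ e (q + s • w) w) (iteratedDeriv 2 (fun s : ℝ => e (q + s • w)) s) s := by
  have h := hasDerivAt_deriv_of_contDiff_two (contDiff_two_line he q w) s
  have heq : deriv (fun s : ℝ => e (q + s • w)) = fun s => fderiv ℝ e (q + s • w) w := funext (deriv_line_eq_fderiv he q w)
  rwa [heq] at h

/-- **Second difference of the slice symbol along a lattice line** (only `C²` data of the band): for `e : V → ℝ` of class `C²` with
`‖D²e‖ ≤ K₂`, `‖Δ_w²[p ↦ Ψ̂_ω(e p)](q)‖ ≤ (32B₂+144B₁+128)(c/Λ³)(|De(q)w| + 2K₂‖w‖²)² + (16B₁+16)(c/Λ²)K₂‖w‖²` — the first-order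
term `|De(q)w|` is the one that is small along the tangent of the frame's Fermi curve (anisotropic gain), the second costs only `K₂`.
[cite: BenfattoGiulianiMastropietro2006, Lemma 2.2 (2.36aa)] -/
theorem norm_fwdDiff_two_sliceSymbol_line_le {e : V → ℝ} (he : ContDiff ℝ 2 e) {K₂ : ℝ} (hK₂ : ∀ p, ‖iteratedFDeriv ℝ 2 e p‖ ≤ K₂)
    (hΛ : 0 < Λ) (hΛΛ' : Λ ≤ Λ') (hc : 0 ≤ c) {B₁ B₂ : ℝ} (hB₁ : ∀ x, |deriv salmhoferCutoff x| ≤ B₁)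
    (hB₂ : ∀ x, |deriv (deriv salmhoferCutoff) x| ≤ B₂) (q w : V) :
    ‖(fwdDiff w)^[2] (fun p => sliceSymbolFnXi c 0 Λ Λ' ω (e p)) q‖ ≤
      (32 * B₂ + 144 * B₁ + 128) * c / Λ ^ 3 * (|fderiv ℝ e q w| + 2 * (K₂ * ‖w‖ ^ 2)) ^ 2 +
        (16 * B₁ + 16) * c / Λ ^ 2 * (K₂ * ‖w‖ ^ 2) := by
  -- reduce to the real line through `q` along `w`
  have e0 := Literature.Analysis.Calculus.fwdDiff_iter_apply_add_smul q w 2 (fun p => sliceSymbolFnXi c 0 Λ Λ' ω (e p)) 0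
  rw [zero_smul, add_zero] at e0
  rw [e0]
  have h := norm_fwdDiff_two_sliceSymbol_path_le (ω := ω) hΛ hΛΛ' hc hB₁ hB₂ (ξ := fun s : ℝ => e (q + s • w))
    (ξd := fun s : ℝ => fderiv ℝ e (q + s • w) w) (ξdd := fun s : ℝ => iteratedDeriv 2 (fun s : ℝ => e (q + s • w)) s)
    (x := 0) (δ := 1) (a := |fderiv ℝ e q w| + 2 * (K₂ * ‖w‖ ^ 2)) (b := K₂ * ‖w‖ ^ 2) zero_le_one
    (fun t _ => hasDerivAt_line he q w t) (fun t _ => hasDerivAt_line_deriv he q w t)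
    (fun t ht => ?_) (fun t _ => abs_iteratedDeriv_two_line_le he hK₂ q w t)
  · simpa only [one_pow, one_mul] using h
  · have hK0 : 0 ≤ K₂ := le_trans (norm_nonneg _) (hK₂ q)
    have h1 := abs_fderiv_line_le he hK₂ q w t
    have ht2 : |t| ≤ 2 := by
      rw [abs_of_nonneg ht.1]; linarith [ht.2]
    have : K₂ * ‖w‖ ^ 2 * |t| ≤ 2 * (K₂ * ‖w‖ ^ 2) := by nlinarith [mul_nonneg hK0 (sq_nonneg ‖w‖)]
    linarith

/-- **First difference of the slice symbol along a lattice line**: `‖Δ_w[p ↦ Ψ̂_ω(e p)](q)‖ ≤ (16B₁+16)(c/Λ²)(|De(q)w| + K₂‖w‖²)`.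
[cite: BenfattoGiulianiMastropietro2006, Lemma 2.2 (2.36aa)] -/
theorem norm_fwdDiff_sliceSymbol_line_le {e : V → ℝ} (he : ContDiff ℝ 2 e) {K₂ : ℝ} (hK₂ : ∀ p, ‖iteratedFDeriv ℝ 2 e p‖ ≤ K₂)
    (hΛ : 0 < Λ) (hΛΛ' : Λ ≤ Λ') (hc : 0 ≤ c) {B₁ : ℝ} (hB₁ : ∀ x, |deriv salmhoferCutoff x| ≤ B₁) (q w : V) :
    ‖fwdDiff w (fun p => sliceSymbolFnXi c 0 Λ Λ' ω (e p)) q‖ ≤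
      (16 * B₁ + 16) * c / Λ ^ 2 * (|fderiv ℝ e q w| + K₂ * ‖w‖ ^ 2) := by
  have e0 := Literature.Analysis.Calculus.fwdDiff_iter_apply_add_smul q w 1 (fun p => sliceSymbolFnXi c 0 Λ Λ' ω (e p)) 0
  rw [zero_smul, add_zero, Function.iterate_one, Function.iterate_one] at e0
  rw [e0]
  have h := norm_fwdDiff_sliceSymbol_path_le (ω := ω) hΛ hΛΛ' hc hB₁ (ξ := fun s : ℝ => e (q + s • w))
    (ξd := fun s : ℝ => fderiv ℝ e (q + s • w) w) (x := 0) (δ := 1) (a := |fderiv ℝ e q w| + K₂ * ‖w‖ ^ 2) zero_le_one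
    (fun t _ => hasDerivAt_line he q w t) (fun t ht => ?_)
  · simpa only [one_mul] using h
  · have hK0 : 0 ≤ K₂ := le_trans (norm_nonneg _) (hK₂ q)
    have h1 := abs_fderiv_line_le he hK₂ q w t
    have ht1 : |t| ≤ 1 := by
      rw [abs_of_nonneg ht.1]; linarith [ht.2]
    have : K₂ * ‖w‖ ^ 2 * |t| ≤ K₂ * ‖w‖ ^ 2 := by nlinarith [mul_nonneg hK0 (sq_nonneg ‖w‖)]
    linarith

end Line

/-! ### §3 The frequency direction -/

section Freq

variable {c Λ Λ' ξ : ℝ}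

/-- **Second difference of the slice symbol in the frequency**: `‖Δ_δ²[t ↦ Ψ_ξ(t)](ω)‖ ≤ δ²·(32B₂+144B₁+128)c/Λ³` for `δ ≥ 0` (the Matsubara
step `δ = 2π/β`). [cite: BenfattoGiulianiMastropietro2006, (2.36aa)] -/
theorem norm_fwdDiff_two_sliceSymbol_freq_le (hΛ : 0 < Λ) (hΛΛ' : Λ ≤ Λ') (hc : 0 ≤ c) {B₁ B₂ : ℝ}
    (hB₁ : ∀ x, |deriv salmhoferCutoff x| ≤ B₁) (hB₂ : ∀ x, |deriv (deriv salmhoferCutoff) x| ≤ B₂) {δ : ℝ} (hδ : 0 ≤ δ) (ω : ℝ) :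
    ‖(fwdDiff δ)^[2] (sliceSymbolFn c 0 Λ Λ' ξ) ω‖ ≤ δ ^ 2 * ((32 * B₂ + 144 * B₁ + 128) * c / Λ ^ 3) :=
  Literature.Analysis.norm_fwdDiff_iter_two_le hδ (fun t _ => hasDerivAt_sliceSymbolFn hΛ hΛΛ' (abs_zero_le_quarter hΛ) t)
    (fun t _ => hasDerivAt_sliceSymbolFnD1 hΛ hΛΛ' (abs_zero_le_quarter hΛ) t)
    (fun t _ => norm_sliceSymbolFnD2_le hΛ hΛΛ' (abs_zero_le_quarter hΛ) hc hB₁ hB₂ t)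

/-- **`‖Ψ′_ξ(ω)‖ ≤ (16B₁+16)c/Λ²`** everywhere — the frequency twin of Literature's `norm_sliceSymbolFnXiD1_le` (`|θ| ≤ Λ/4`).
[cite: BenfattoGiulianiMastropietro2006, (2.36aa)] -/
theorem norm_sliceSymbolFnD1_le {θ : ℝ} (hΛ : 0 < Λ) (hΛΛ' : Λ ≤ Λ') (hθ : |θ| ≤ Λ / 4) (hc : 0 ≤ c) {B₁ : ℝ}
    (hB₁ : ∀ x, |deriv salmhoferCutoff x| ≤ B₁) (ω : ℝ) :
    ‖sliceSymbolFnD1 c θ Λ Λ' ξ ω‖ ≤ (16 * B₁ + 16) * c / Λ ^ 2 := by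
  have hB10 : 0 ≤ B₁ := (abs_nonneg _).trans (hB₁ 0)
  by_cases hmem : ω ^ 2 + ξ ^ 2 < Λ ^ 2 / 4 ∨ Λ' ^ 2 < ω ^ 2 + ξ ^ 2
  · obtain ⟨h0, h1, -⟩ := sliceWeightFn_eq_zero_of_not_mem hΛ hΛΛ' hmem
    rw [sliceSymbolFnD1, h0, h1, Complex.ofReal_zero]
    simp only [zero_mul, add_zero, norm_zero]
    positivity
  · rw [not_or, not_lt, not_lt] at hmem
    have hden := norm_shiftDen_ge hθ hmem.1
    set a := ‖-I * ((ω + θ : ℝ) : ℂ) + (ξ : ℂ)‖ with ha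
    have ha0 : 0 < a := lt_of_lt_of_le (by positivity) hden
    have hR : ‖resolventFn c θ ξ ω‖ ≤ 4 * c / Λ := by
      rw [norm_resolventFn hc, div_le_div_iff₀ ha0 hΛ]; nlinarith
    have hR1 : ‖resolventFnD1 c θ ξ ω‖ ≤ 16 * c / Λ ^ 2 := by
      rw [norm_resolventFnD1 hc, div_le_div_iff₀ (by positivity) (by positivity)]
      have : Λ ^ 2 ≤ 16 * a ^ 2 := by nlinarith
      nlinarith
    have hW : ‖(sliceWeightFn Λ Λ' ξ ω : ℂ)‖ ≤ 1 := by
      rw [Complex.norm_real, Real.norm_eq_abs]; exact abs_sliceWeightFn_le_one Λ Λ' ξ ω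
    have hW1 : ‖(sliceWeightFnD1 Λ Λ' ξ ω : ℂ)‖ ≤ 4 * B₁ / Λ := by
      rw [Complex.norm_real, Real.norm_eq_abs]; exact abs_sliceWeightFnD1_le hB₁ hΛ hΛΛ' ξ ω
    rw [sliceSymbolFnD1]
    calc _ ≤ ‖(sliceWeightFnD1 Λ Λ' ξ ω : ℂ) * resolventFn c θ ξ ω‖ + ‖(sliceWeightFn Λ Λ' ξ ω : ℂ) * resolventFnD1 c θ ξ ω‖ :=
          norm_add_le _ _
      _ ≤ 4 * B₁ / Λ * (4 * c / Λ) + 1 * (16 * c / Λ ^ 2) := by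
          refine add_le_add ?_ ?_
          · rw [norm_mul]; exact mul_le_mul hW1 hR (norm_nonneg _) (by positivity)
          · rw [norm_mul]; exact mul_le_mul hW hR1 (norm_nonneg _) zero_le_one
      _ = (16 * B₁ + 16) * c / Λ ^ 2 := by field_simp; ring

/-- **First difference in the frequency**: `‖Δ_δ Ψ_ξ(ω)‖ ≤ δ·(16B₁+16)c/Λ²`. [cite: BenfattoGiulianiMastropietro2006, (2.36aa)] -/
theorem norm_fwdDiff_sliceSymbol_freq_le (hΛ : 0 < Λ) (hΛΛ' : Λ ≤ Λ') (hc : 0 ≤ c) {B₁ : ℝ}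
    (hB₁ : ∀ x, |deriv salmhoferCutoff x| ≤ B₁) {δ : ℝ} (hδ : 0 ≤ δ) (ω : ℝ) :
    ‖fwdDiff δ (sliceSymbolFn c 0 Λ Λ' ξ) ω‖ ≤ δ * ((16 * B₁ + 16) * c / Λ ^ 2) := by
  rw [fwdDiff]
  exact Literature.Analysis.norm_sub_le_of_norm_deriv_le hδ
    (fun t _ => hasDerivAt_sliceSymbolFn hΛ hΛΛ' (abs_zero_le_quarter hΛ) t)
    fun t _ => norm_sliceSymbolFnD1_le hΛ hΛΛ' (abs_zero_le_quarter hΛ) hc hB₁ t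

end Freq

end Summit.HubbardSuperconductivity.HubbardSuperconductivity.Theorems.TorusFourierL2

end
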